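import Summits.BirchSwinnertonDyer.BirchSwinnertonDyer.Theorems.BiquadraticEisensteinDescentHeegnerTwistCouplingInSupplySqrtTwoCell
import Summits.BirchSwinnertonDyer.BirchSwinnertonDyer.Theorems.BiquadraticEisensteinDescentHeegnerTwistCouplingInSupplySqrtTwoLaw
import Literature.NumberTheory.EllipticCurves.BinaryQuarticDiscriminantFpCountProofs
import HarnessLib

set_option linter.dupNamespace false -- `Summit.BirchSwinnertonDyer.BirchSwinnertonDyer.Theorems.…` (summit = sub)
set_option autoImplicit false

/-!
# Crux `HeegnerTwistCouplingInSupply` (stmt-BirchSwinnertonDyer-21381) — card `sqrt2-isogeny-heegner-pin`, CELL-15, part 1 (LOCAL LAYER):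
# rootless reduced quartics, the `2 ± √2` law at the inert prime `p`, and the `2`-adic classes `p, 2p`, for
# `B_{−m} : y² = x³ − 4m x² + 2m² x` with `m = p·m′`

Route `BiquadraticEisensteinDescent` (cell `pub/bsd-wall`, width seat `bsd-wall-cm-bed-w2` g12; `--supports` 21381, helper). Sequel to
`…SqrtTwoCell` (seat `bed-w1` g10: CELL-5 and the generic layer — the `(2/r) = −1` law `not_isSoluble_padic_of_prime_factor`, the
`2`-adic classes `−1, −2`, `lit_B`, `isElliptic_B`), imported BY NAME. CELL-15 is the card's second cell: the twist parameter `m = pm′`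
contains the inert prime `p` itself (`p ≡ 7 (mod 8)` has `(2/p) = +1`, so the `(2/·)` law is silent at `p`); the classes divisible
by `p` are decided by the card's `2 ± √2` law — `2 ± √2` are squares in `𝔽_p` when `x⁴ − 4x² + 2` has a root mod `p`, i.e.
`p ≡ 15 (mod 16)` (`…SqrtTwoLaw.twoPlusSqrtTwoIsSquare`, p651809) — together with `(m′/p) = −1`. This file:

* `not_isSoluble_padic_of_dvd_of_rootless` — `d = r d₁`, `A = r A₁`, `e = r e₁` and the reduced quartics `d₁ + A₁t² + e₁t⁴`,
  `e₁ + A₁t² + d₁t⁴` ROOTLESS mod `r` ⇒ `w² = d u⁴ + A u²z² + e z⁴` has no `ℚ_r`-point (the rootless form of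
  `…SqrtTwoCell.not_isSoluble_padic_of_dvd_of_not_isSquare_disc`); `rootless_both_of_rootless` (`t ↦ t⁻¹`);
* ★ `isSquare_of_root_of_twoPlusSqrtTwo` — in a field with `2 ≠ 0` and `x⁴ − 4x² + 2 = 0`, every root of `t⁴ − 4ct² + 2c² = 0`
  exhibits `c` as a square (`s = x² − 2`, `s² = 2`, `(t² − 2c)² = 2c²`, `t² = c(2 ± s)`, `2 + s = x²`, `2 − s = (s/x)²`);
* ★ `not_isSoluble_padic_hat_at_p` / `not_isSoluble_padic_prime_at_p` — for `m = pm′`, `(m′/p) = −1`: the `φ̂`-classes `p, 2p`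
  (`w² = p u⁴ − 4m u²z² + 2pm′² z⁴`, `w² = 2p u⁴ − 4m u²z² + pm′² z⁴`) and the `φ`-classes `−p, −2p` (`w² = −p u⁴ + 8m u²z² − 8pm′² z⁴`,
  `w² = −2p u⁴ + 8m u²z² − 4pm′² z⁴`) have no `ℚ_p`-point (reduced quartics `t⁴ − 4m′t² + 2m′²`, `2t⁴ − 4m′t² + m′²` via `t ↦ st`,
  `−t⁴ + 8m′t² − 8m′²` via `c = 2m′` and `2 = s²`, `−2t⁴ + 8m′t² − 4m′²` via `× (−½)`);
* `not_isSoluble_two_of_emod` — residue classes `(d, A, e) ≡ (15,8,8), (7,8,8), (14,8,12) (mod 16)` have no `ℚ₂`-point (tables by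
  `decide` in `ZMod (2^4)`, transported by `GoldfeldGoodTwists.not_isSoluble_two_of_zmodPow`); `not_isSoluble_two_p_and_two_p` — the
  `φ`-classes `p, 2p` (`e = 8pm′², 4pm′²`) die at `2` for `p ≡ 7 (mod 8)`, `m = pm′` odd (card: "`α′(p)`: `X` odd ⇒ `Y² ≡ 7 (8)`,
  `X` even ⇒ `v₂ = 3`").

THEOREMS ONLY (no `def`, no named fact); nothing about `L`-values, the crux (all CM `W`) or BSD is asserted. Supports
stmt-BirchSwinnertonDyer-21381. BSD is not proved by any of this.
-/

noncomputable section

open scoped Classical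

namespace Summit.BirchSwinnertonDyer.BirchSwinnertonDyer.Theorems.BiquadraticEisensteinDescentHeegnerTwistCouplingInSupplySqrtTwoCellFifteenLocal

open _root_.WeierstrassCurve Literature.NumberTheory.EllipticCurves
open Literature.NumberTheory.EllipticCurves.Zywina2025 (exists_padicInt_of_isSoluble)
open Summit.BirchSwinnertonDyer.BirchSwinnertonDyer.Theorems.GoldfeldGoodTwists (not_isSoluble_two_of_zmodPow)
open Summit.BirchSwinnertonDyer.BirchSwinnertonDyer.Theorems.BiquadraticEisensteinDescentHeegnerTwistCouplingInSupplySqrtTwoCell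

/-! ## The local layer: rootless reduced quartics, the `2 ± √2` law at `p`, the classes `p, 2p` at `2` -/

section Local

/-- **Reduction lemma, ROOTLESS form** (the discriminant form is `…SqrtTwoCell.not_isSoluble_padic_of_dvd_of_not_isSquare_disc`).
For `w² = d u⁴ + A u²z² + e z⁴` with `d = r d₁`, `A = r A₁`, `e = r e₁`: a `ℚ_r`-point gives `s² = f + A t² + f′ t⁴` in `ℤ_r` in one
of the two charts (`(f, f′) = (d, e)` or `(e, d)`), then `r ∣ s` and the reduced quartic `f₁ + A₁ t² + f₁′ t⁴` has a root in `𝔽_r`.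
So if `d₁ + A₁t² + e₁t⁴` and `e₁ + A₁t² + d₁t⁴` are both rootless mod `r` there is no `ℚ_r`-point.
[cite: SilvermanAEC2009, Prop. X.4.9 (local conditions on the homogeneous spaces C_d)] -/
theorem not_isSoluble_padic_of_dvd_of_rootless {r : ℕ} [Fact r.Prime] {A d e A₁ d₁ e₁ : ℤ}
    (hA : A = r * A₁) (hd : d = r * d₁) (he : e = r * e₁)
    (h : ∀ t : ZMod r, (d₁ : ZMod r) + (A₁ : ZMod r) * t ^ 2 + (e₁ : ZMod r) * t ^ 4 ≠ 0 ∧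
      (e₁ : ZMod r) + (A₁ : ZMod r) * t ^ 2 + (d₁ : ZMod r) * t ^ 4 ≠ 0) :
    ¬ ((twoIsogenyQuartic A d e).map (Int.castRingHom ℚ_[r])).IsSoluble := by
  have hrr : Prime (r : ℤ_[r]) := PadicInt.prime_p
  intro hsol
  obtain ⟨f, f', hff, t, s, hs⟩ := exists_padicInt_of_isSoluble hsol
  obtain ⟨f₁, f₁', hf, hf', hroot⟩ : ∃ f₁ f₁' : ℤ, f = r * f₁ ∧ f' = r * f₁' ∧
      ∀ t : ZMod r, (f₁ : ZMod r) + (A₁ : ZMod r) * t ^ 2 + (f₁' : ZMod r) * t ^ 4 ≠ 0 := by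
    rcases hff with ⟨rfl, rfl⟩ | ⟨rfl, rfl⟩
    · exact ⟨d₁, e₁, hd, he, fun t => (h t).1⟩
    · exact ⟨e₁, d₁, he, hd, fun t => (h t).2⟩
  rw [hf, hf', hA] at hs
  push_cast at hs
  have hs2 : (r : ℤ_[r]) ∣ s ^ 2 := ⟨f₁ + A₁ * t ^ 2 + f₁' * t ^ 4, by rw [hs]; ring⟩
  obtain ⟨s₁, rfl⟩ := hrr.dvd_of_dvd_pow hs2
  have h1 : (f₁ : ℤ_[r]) + A₁ * t ^ 2 + f₁' * t ^ 4 = r * s₁ ^ 2 :=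
    mul_left_cancel₀ hrr.ne_zero (by linear_combination -hs)
  have h0 := congrArg PadicInt.toZMod h1
  simp only [map_add, map_mul, map_pow, map_intCast, map_natCast, ZMod.natCast_self, zero_mul] at h0
  exact hroot _ h0

/-- From the chart `z = 1` to both charts: if `d₁ ≢ 0` and `e₁ + A₁ t² + d₁ t⁴` is rootless modulo `r`, then so is
`d₁ + A₁ t² + e₁ t⁴` (a root `t ≠ 0` of the latter gives the root `t⁻¹` of the former). [folklore] -/
theorem rootless_both_of_rootless {F : Type*} [Field F] {d₁ A₁ e₁ : F} (hd₁ : d₁ ≠ 0)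
    (h : ∀ t : F, e₁ + A₁ * t ^ 2 + d₁ * t ^ 4 ≠ 0) (t : F) :
    d₁ + A₁ * t ^ 2 + e₁ * t ^ 4 ≠ 0 ∧ e₁ + A₁ * t ^ 2 + d₁ * t ^ 4 ≠ 0 := by
  refine ⟨fun ht => ?_, h t⟩
  have ht0 : t ≠ 0 := by rintro rfl; exact hd₁ (by linear_combination ht)
  apply h t⁻¹
  have h1 : t⁻¹ * t = 1 := inv_mul_cancel₀ ht0
  have : e₁ + A₁ * t⁻¹ ^ 2 + d₁ * t⁻¹ ^ 4 = t⁻¹ ^ 4 * (d₁ + A₁ * t ^ 2 + e₁ * t ^ 4) := by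
    linear_combination (-(A₁ * t⁻¹ ^ 2 * (t⁻¹ * t + 1) + e₁ * (t⁻¹ * t + 1) * ((t⁻¹ * t) ^ 2 + 1))) * h1
  rw [this, ht, mul_zero]

/-- **The `2 ± √2` mechanism.** In a field with `2 ≠ 0`, if `x⁴ − 4x² + 2 = 0` (so `s = x² − 2` is a square root of `2`,
`2 + s = x²` and `2 − s = (s/x)²`) then every root `t` of `t⁴ − 4c t² + 2c² = 0` exhibits `c` as a square:
`(t² − 2c)² = 2c²` gives `t² = c(2 ± s)`. (Card: "`T` is a square iff `(m′/p) = +1`".) [folklore] -/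
theorem isSquare_of_root_of_twoPlusSqrtTwo {F : Type*} [Field F] (h2 : (2 : F) ≠ 0) {x : F}
    (hx : x ^ 4 - 4 * x ^ 2 + 2 = 0) {c t : F} (ht : t ^ 4 - 4 * c * t ^ 2 + 2 * c ^ 2 = 0) : IsSquare c := by
  obtain ⟨s, hs⟩ : ∃ s : F, s = x ^ 2 - 2 := ⟨_, rfl⟩
  have hs2 : s ^ 2 = 2 := by rw [hs]; linear_combination hx
  have hx0 : x ≠ 0 := by rintro rfl; apply h2; linear_combination hx
  have hs0 : s ≠ 0 := by intro h0; apply h2; rw [← hs2, h0]; ring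
  have hsq : (t ^ 2 - 2 * c) ^ 2 = (s * c) ^ 2 := by linear_combination ht - c ^ 2 * hs2
  rcases sq_eq_sq_iff_eq_or_eq_neg.mp hsq with h | h
  · refine ⟨t / x, ?_⟩
    rw [div_mul_div_comm, eq_div_iff (mul_ne_zero hx0 hx0)]
    linear_combination (-1) * h - c * hs
  · refine ⟨t * x / s, ?_⟩
    rw [div_mul_div_comm, eq_div_iff (mul_ne_zero hs0 hs0)]
    linear_combination (-x ^ 2) * h + 2 * c * hs2 + c * (2 - s) * hs

/-- `IsSquare (2c)` with `2 = s²`, `s ≠ 0` gives `IsSquare c`. [folklore] -/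
theorem isSquare_of_isSquare_two_mul {F : Type*} [Field F] {s c : F} (hs2 : s ^ 2 = 2) (hs0 : s ≠ 0)
    (h : IsSquare (2 * c)) : IsSquare c := by
  obtain ⟨y, hy⟩ := h
  refine ⟨y / s, ?_⟩
  rw [div_mul_div_comm, eq_div_iff (mul_ne_zero hs0 hs0)]
  linear_combination hy + c * hs2

/-- Transfer of a residue modulo `16` to `ℤ/2⁴`. [folklore] -/
theorem intCast_zmod_two_pow_four {x c : ℤ} (h : x % 16 = c) : (x : ZMod (2 ^ 4)) = (c : ZMod (2 ^ 4)) := by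
  rw [ZMod.intCast_eq_intCast_iff]
  show x % ((2 ^ 4 : ℕ) : ℤ) = c % ((2 ^ 4 : ℕ) : ℤ)
  norm_num
  omega

/-- Residue table `(15, 8, 8)`: `S² ≢ 15 + 8T² + 8T⁴`, `S² ≢ 8 + 8T² + 15T⁴ (mod 16)`. [folklore] -/
theorem table_fifteen : ∀ T S : ZMod (2 ^ 4),
    S ^ 2 ≠ ((15 : ℤ) : ZMod (2 ^ 4)) + ((8 : ℤ) : ZMod (2 ^ 4)) * T ^ 2 + ((8 : ℤ) : ZMod (2 ^ 4)) * T ^ 4 ∧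
      S ^ 2 ≠ ((8 : ℤ) : ZMod (2 ^ 4)) + ((8 : ℤ) : ZMod (2 ^ 4)) * T ^ 2 + ((15 : ℤ) : ZMod (2 ^ 4)) * T ^ 4 := by
  decide

/-- Residue table `(7, 8, 8)`: `S² ≢ 7 + 8T² + 8T⁴`, `S² ≢ 8 + 8T² + 7T⁴ (mod 16)`. [folklore] -/
theorem table_seven : ∀ T S : ZMod (2 ^ 4),
    S ^ 2 ≠ ((7 : ℤ) : ZMod (2 ^ 4)) + ((8 : ℤ) : ZMod (2 ^ 4)) * T ^ 2 + ((8 : ℤ) : ZMod (2 ^ 4)) * T ^ 4 ∧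
      S ^ 2 ≠ ((8 : ℤ) : ZMod (2 ^ 4)) + ((8 : ℤ) : ZMod (2 ^ 4)) * T ^ 2 + ((7 : ℤ) : ZMod (2 ^ 4)) * T ^ 4 := by
  decide

/-- Residue table `(14, 8, 12)`: `S² ≢ 14 + 8T² + 12T⁴`, `S² ≢ 12 + 8T² + 14T⁴ (mod 16)`. [folklore] -/
theorem table_fourteen : ∀ T S : ZMod (2 ^ 4),
    S ^ 2 ≠ ((14 : ℤ) : ZMod (2 ^ 4)) + ((8 : ℤ) : ZMod (2 ^ 4)) * T ^ 2 + ((12 : ℤ) : ZMod (2 ^ 4)) * T ^ 4 ∧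
      S ^ 2 ≠ ((12 : ℤ) : ZMod (2 ^ 4)) + ((8 : ℤ) : ZMod (2 ^ 4)) * T ^ 2 + ((14 : ℤ) : ZMod (2 ^ 4)) * T ^ 4 := by
  decide

/-- **`2`-adic classes by residues `(d, A, e) (mod 16)`**: each of `(15, 8, 8)`, `(7, 8, 8)`, `(14, 8, 12)` makes
`w² = d u⁴ + A u²z² + e z⁴` insoluble over `ℚ₂` (no primitive solution modulo `16` in either chart).
[cite: SilvermanAEC2009, proof of Prop. X.6.2(b) (C₂: «no solutions modulo 16»)] -/
theorem not_isSoluble_two_of_emod {A d e : ℤ} (hA : A % 16 = 8)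
    (hde : (d % 16 = 15 ∧ e % 16 = 8) ∨ (d % 16 = 7 ∧ e % 16 = 8) ∨ (d % 16 = 14 ∧ e % 16 = 12)) :
    ¬ ((twoIsogenyQuartic A d e).map (Int.castRingHom ℚ_[2])).IsSoluble := by
  refine not_isSoluble_two_of_zmodPow 4 4 (fun T S => ?_) (fun T S => ?_) <;>
    rcases hde with ⟨hd, he⟩ | ⟨hd, he⟩ | ⟨hd, he⟩ <;>
    rw [intCast_zmod_two_pow_four hd, intCast_zmod_two_pow_four hA, intCast_zmod_two_pow_four he]
  exacts [(table_fifteen T S).1, (table_seven T S).1, (table_fourteen T S).1,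
    (table_fifteen T S).2, (table_seven T S).2, (table_fourteen T S).2]

/-- `8 m² ≡ 8 (mod 16)` and `4 m² ≡ 4 (mod 16)` for odd `m`. [folklore] -/
theorem sq_emod_sixteen_of_odd {m : ℤ} (hm : Odd m) : (8 * m ^ 2) % 16 = 8 ∧ (4 * m ^ 2) % 16 = 4 := by
  obtain ⟨k, hk⟩ := hm
  have h1 : m ^ 2 = 4 * (k * (k + 1)) + 1 := by rw [hk]; ring
  have h2 : (2 : ℤ) ∣ k * (k + 1) := (Int.even_mul_succ_self k).two_dvd
  omega

/-- **`φ`-side classes `d = p` and `d = 2p` at the prime `2`** for `p ≡ 7 (mod 8)` and `m = p m′` odd (complementary divisors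
`8pm′²`, `4pm′²`): no `ℚ₂`-point — residues `(7 or 15, 8, 8)` and `(14, 8, 12) (mod 16)` (card CELL-15: "`α′(p)`: `X` odd ⇒
`Y² ≡ p ≡ 7 (mod 8)`, `X` even ⇒ `v₂ = 3`"). [cite: SilvermanAEC2009, proof of Prop. X.6.2(b) (C₂: «no solutions modulo 16»)] -/
theorem not_isSoluble_two_p_and_two_p {p m m' : ℤ} (hp8 : p % 8 = 7) (hm : m = p * m') (hm' : Odd m') :
    ¬ ((twoIsogenyQuartic (8 * m) p (8 * p * m' ^ 2)).map (Int.castRingHom ℚ_[2])).IsSoluble ∧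
      ¬ ((twoIsogenyQuartic (8 * m) (2 * p) (4 * p * m' ^ 2)).map (Int.castRingHom ℚ_[2])).IsSoluble := by
  have hpo : Odd p := Int.odd_iff.mpr (by omega)
  obtain ⟨h8, h4⟩ := sq_emod_sixteen_of_odd hm'
  have hA : (8 * m) % 16 = 8 := by
    obtain ⟨k, hk⟩ := hpo.mul hm'
    rw [hm, hk]; omega
  have he8 : (8 * p * m' ^ 2) % 16 = 8 := by
    obtain ⟨j, hj⟩ := hpo.mul (hm'.pow (n := 2))
    have : 8 * p * m' ^ 2 = 16 * j + 8 := by linear_combination 8 * hj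
    omega
  have he12 : (4 * p * m' ^ 2) % 16 = 12 := by
    obtain ⟨k, hk⟩ := hm'
    have h1 : m' ^ 2 = 4 * (k * (k + 1)) + 1 := by rw [hk]; ring
    have : 4 * p * m' ^ 2 = 16 * (p * (k * (k + 1))) + 4 * p := by rw [h1]; ring
    omega
  refine ⟨not_isSoluble_two_of_emod hA ?_, not_isSoluble_two_of_emod hA (Or.inr (Or.inr ⟨by omega, he12⟩))⟩
  rcases (show p % 16 = 7 ∨ p % 16 = 15 by omega) with h | h
  · exact Or.inr (Or.inl ⟨h, he8⟩)
  · exact Or.inl ⟨h, he8⟩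

variable {p : ℕ} [Fact p.Prime]

/-- **At the inert prime `p` with `x⁴ − 4x² + 2 = 0` soluble mod `p` (`p ≡ 15 (mod 16)`), `φ̂`-side classes `d = p, 2p`**: for
`m = p m′` with `(m′/p) = −1` the homogeneous spaces `w² = p u⁴ − 4m u²z² + 2pm′² z⁴` and `w² = 2p u⁴ − 4m u²z² + p m′² z⁴` have no
`ℚ_p`-point: the reduced quartics `t⁴ − 4m′t² + 2m′²` and `2t⁴ − 4m′t² + m′²` (substitute `st`, `s² = 2`) are rootless because a root
exhibits `m′` as a square (card CELL-15: "`α(p)` has no `ℚ_p`-point"). [cite: SilvermanAEC2009, Prop. X.4.9 (local conditions on C_d)] -/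
theorem not_isSoluble_padic_hat_at_p (hp2 : p ≠ 2) {x : ZMod p} (hx : x ^ 4 - 4 * x ^ 2 + 2 = 0)
    {m m' : ℤ} (hm : m = p * m') (hm' : ¬ IsSquare (m' : ZMod p)) :
    ¬ ((twoIsogenyQuartic (-4 * m) p (2 * p * m' ^ 2)).map (Int.castRingHom ℚ_[p])).IsSoluble ∧
      ¬ ((twoIsogenyQuartic (-4 * m) (2 * p) (p * m' ^ 2)).map (Int.castRingHom ℚ_[p])).IsSoluble := by
  have h2 := BinaryQuartic.two_ne_zero_zmod (p := p) hp2
  obtain ⟨s, hs⟩ : ∃ s : ZMod p, s = x ^ 2 - 2 := ⟨_, rfl⟩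
  have hs2 : s ^ 2 = 2 := by rw [hs]; linear_combination hx
  constructor
  · refine not_isSoluble_padic_of_dvd_of_rootless (A₁ := -4 * m') (d₁ := 1) (e₁ := 2 * m' ^ 2)
      (by rw [hm]; ring) (by ring) (by ring) (rootless_both_of_rootless (by norm_num) fun t ht => hm' ?_)
    push_cast at ht
    exact isSquare_of_root_of_twoPlusSqrtTwo h2 hx (t := t) (by linear_combination ht)
  · refine not_isSoluble_padic_of_dvd_of_rootless (A₁ := -4 * m') (d₁ := 2) (e₁ := m' ^ 2)
      (by rw [hm]; ring) (by ring) (by ring) (rootless_both_of_rootless (by exact_mod_cast h2) fun t ht => hm' ?_)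
    push_cast at ht
    exact isSquare_of_root_of_twoPlusSqrtTwo h2 hx (t := s * t)
      (by linear_combination 2 * ht + (t ^ 4 * (s ^ 2 + 2) - 4 * (m' : ZMod p) * t ^ 2) * hs2)

/-- **At the inert prime `p` with `x⁴ − 4x² + 2 = 0` soluble mod `p`, `φ`-side classes `d = −p, −2p`**: for `m = p m′` with
`(m′/p) = −1` the homogeneous spaces `w² = −p u⁴ + 8m u²z² − 8pm′² z⁴` and `w² = −2p u⁴ + 8m u²z² − 4pm′² z⁴` have no `ℚ_p`-point
(reduced quartics `−t⁴ + 8m′t² − 8m′²` — `c = 2m′`, then `2 = s²` — and `−2t⁴ + 8m′t² − 4m′²`; card: "`α′(−p)` has no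
`ℚ_p`-point"). [cite: SilvermanAEC2009, Prop. X.4.9 (local conditions on C_d)] -/
theorem not_isSoluble_padic_prime_at_p (hp2 : p ≠ 2) {x : ZMod p} (hx : x ^ 4 - 4 * x ^ 2 + 2 = 0)
    {m m' : ℤ} (hm : m = p * m') (hm' : ¬ IsSquare (m' : ZMod p)) :
    ¬ ((twoIsogenyQuartic (8 * m) (-p) (-(8 * p * m' ^ 2))).map (Int.castRingHom ℚ_[p])).IsSoluble ∧
      ¬ ((twoIsogenyQuartic (8 * m) (-(2 * p)) (-(4 * p * m' ^ 2))).map (Int.castRingHom ℚ_[p])).IsSoluble := by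
  have h2 := BinaryQuartic.two_ne_zero_zmod (p := p) hp2
  obtain ⟨s, hs⟩ : ∃ s : ZMod p, s = x ^ 2 - 2 := ⟨_, rfl⟩
  have hs2 : s ^ 2 = 2 := by rw [hs]; linear_combination hx
  have hs0 : s ≠ 0 := by intro h0; apply h2; rw [← hs2, h0]; ring
  constructor
  · refine not_isSoluble_padic_of_dvd_of_rootless (A₁ := 8 * m') (d₁ := -1) (e₁ := -(8 * m' ^ 2))
      (by rw [hm]; ring) (by ring) (by ring)
      (rootless_both_of_rootless (by push_cast; exact neg_ne_zero.mpr one_ne_zero) fun t ht => hm' ?_)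
    push_cast at ht
    refine isSquare_of_isSquare_two_mul hs2 hs0 ?_
    exact isSquare_of_root_of_twoPlusSqrtTwo h2 hx (c := 2 * m') (t := t) (by linear_combination (-1) * ht)
  · refine not_isSoluble_padic_of_dvd_of_rootless (A₁ := 8 * m') (d₁ := -2) (e₁ := -(4 * m' ^ 2))
      (by rw [hm]; ring) (by ring) (by ring)
      (rootless_both_of_rootless (by push_cast; exact neg_ne_zero.mpr h2) fun t ht => hm' ?_)
    push_cast at ht
    have h2inv : (2 : ZMod p)⁻¹ * 2 = 1 := inv_mul_cancel₀ h2
    exact isSquare_of_root_of_twoPlusSqrtTwo h2 hx (t := t)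
      (by linear_combination (-(2 : ZMod p)⁻¹) * ht - (t ^ 4 - 4 * (m' : ZMod p) * t ^ 2 + 2 * (m' : ZMod p) ^ 2) * h2inv)

end Local

end Summit.BirchSwinnertonDyer.BirchSwinnertonDyer.Theorems.BiquadraticEisensteinDescentHeegnerTwistCouplingInSupplySqrtTwoCellFifteenLocal

end
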